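import Literature.Probability.LatticeModels.HalfPlaneClusterSides
import Literature.Probability.Percolation.HalfAnnulusDuality
import Literature.Probability.Percolation.StarWindingBands
import Literature.Probability.Percolation.WindingTypes
import Literature.Probability.Percolation.StripCrossing
import HarnessLib

/-!
# Uniqueness of infinite clusters in half-planes (Georgii–Higuchi 2000, Lemma 4.1, first part)

Topic `Probability/LatticeModels`. Georgii–Higuchi's Lemma 4.1: "For any half-plane `π`, there
exists `𝒢`-almost surely at most one infinite `+` (resp. `+∗`) cluster in `π`." GH derive this from
the line-touching property (the tree's `ae_infinite_cluster_touches_axis_io`): "suppose there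
exists no infinite `−∗`cluster in `π_up`; then each finite set in `π_up` is surrounded by a
`+`semicircuit, so that any two infinite `+`paths are `+`connected to each other. In the
alternative case when an infinite `−∗`cluster exists, it meets `ℓ_left` or `ℓ_right` infinitely
often, so that each infinite `+`cluster must meet the other half-line infinitely often. Hence,
two such `+`clusters must cross each other, and are thus identical."

We give a deterministic core for a configuration in which every infinite cluster of the four
types (`±`, lattice/`∗`) in `π_up` touches the axis at sites of arbitrarily large `|x₁|`:

* the traces on the axis of two disjoint infinite structures that cannot cross do not interleave
  (`not_between_of_starArc`, from the eye lemma; `not_between_of_sameStar`, same-colour `∗`);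
* two disjoint infinite lattice clusters of one colour: between their (ordered) traces an infinite
  `∗`cluster of the other colour is built (Deuschel–Pisztora boundary of a truncation, folded), whose
  own far touch is blocked — **`latticeCluster_unique_of_touching`**;
* two disjoint infinite `∗`clusters of one colour: if an infinite lattice cluster of the other
  colour exists, three pairwise non-interleaving infinite traces are impossible; otherwise
  half-annulus duality (`exists_starSemicircuit_or_latticeEscape`) gives same-colour
  `∗`semicircuits around every box, which both clusters meet — **`starCluster_unique_of_touching`**;
* almost-sure versions for `μ ∈ 𝒢(β, 0)`, `β > β_c` — **`ae_latticeCluster_unique_halfPlane`**,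
  **`ae_starCluster_unique_halfPlane`** (both colours).

## References

* H.-O. Georgii, Y. Higuchi, J. Math. Phys. 41 (2000), Lemma 4.1 [GeorgiiHiguchi2000].
* L. Russo, CMP 67 (1979) [Russo1979].
-/

noncomputable section

open MeasureTheory SimpleGraph Finset
open Literature.Probability.Percolation
open scoped ENNReal

namespace Literature.Probability.LatticeModels

/-! ### Traces on the axis -/

/-- The trace of a set of sites on the horizontal axis. [cite: GeorgiiHiguchi2000, Lemma 4.1] -/
def axisTrace (C : Set (Site 2)) : Set ℤ := {t | mkSite t 0 ∈ C}

/-- A set of sites touches the axis unboundedly: at columns of arbitrarily large modulus. [cite: GeorgiiHiguchi2000, Lemma 4.1 ("intersects the boundary line infinitely often")] -/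
def TouchesUnboundedly (C : Set (Site 2)) : Prop := ∀ n : ℕ, ∃ t ∈ axisTrace C, (n : ℤ) < |t|

/-- Axis sites in coordinates. [folklore] -/
theorem eq_mkSite_of_axis {z : Site 2} (hz : z 1 = 0) : z = mkSite (z 0) 0 := by
  ext i; fin_cases i
  · rfl
  · exact hz

/-- The reflection fixes axis sites. [folklore] -/
theorem Rf_mkSite_zero (t : ℤ) : Rf (mkSite t 0) = mkSite t 0 := by
  ext i; fin_cases i
  · exact Rf_apply_zero _
  · change Rf (mkSite t 0) 1 = 0; rw [Rf_apply_one]; simp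

/-! ### Clusters: elementary facts -/

section Clusters

variable {G : SimpleGraph (Site 2)} {O : Set (Site 2)} {x : Site 2}

/-- Two sites of a cluster are joined by a walk of the underlying graph inside the cluster. [folklore] -/
theorem exists_walk_in_siteCluster {p q : Site 2} (hp : p ∈ siteCluster G O x) (hq : q ∈ siteCluster G O x) :
    ∃ w : G.Walk p q, ∀ z ∈ w.support, z ∈ siteCluster G O x := by
  obtain ⟨w⟩ := hp.2.2.symm.trans hq.2.2
  refine ⟨w.mapLe (fun u v huv => ((siteOpenGraph_adj _ _ _ _).1 huv).1), fun z hz => ?_⟩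
  rw [Walk.support_mapLe_eq_support] at hz
  exact ⟨hp.1, support_subset_of_siteOpenGraph_walk w hp.2.1 z hz, hp.2.2.trans (w.takeUntil z hz).reachable⟩

/-- An infinite cluster reaches outside every box. [folklore] -/
theorem exists_mem_siteCluster_not_mem_box (hinf : (siteCluster G O x).Infinite) (H : ℕ) :
    ∃ w ∈ siteCluster G O x, w ∉ box 2 H := by
  by_contra h; push Not at h
  exact hinf ((box 2 H).finite_toSet.subset fun w hw => h w hw)

end Clusters

/-! ### Non-interleaving from the eye lemma -/

/-- **A `∗`arc blocks lattice escapes**: if `A ⊆ π_up` is `∗`-connected inside itself and disjoint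
from an infinite lattice cluster `B` of sites of `π_up`, then no axis site of `B` lies strictly
between two axis sites of `A`. [cite: GeorgiiHiguchi2000, Lemma 4.1 (proof: "two such clusters must cross each other")] -/
theorem not_between_of_starArc {A : Set (Site 2)} (hAup : A ⊆ halfPlane 0)
    (hAconn : ∀ p ∈ A, ∀ q ∈ A, ∃ w : zdStarGraph.Walk p q, ∀ z ∈ w.support, z ∈ A)
    {O : Set (Site 2)} (hO : O ⊆ halfPlane 0) {xb : Site 2} (hB : (siteCluster (zdGraph 2) O xb).Infinite)
    (hdisj : ∀ z ∈ A, z ∉ siteCluster (zdGraph 2) O xb)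
    {t₁ t₂ c : ℤ} (ht₁ : mkSite t₁ 0 ∈ A) (ht₂ : mkSite t₂ 0 ∈ A) (hc : mkSite c 0 ∈ siteCluster (zdGraph 2) O xb)
    (h1 : t₁ < c) (h2 : c < t₂) : False := by
  classical
  obtain ⟨α, hα⟩ := hAconn _ ht₁ _ ht₂
  obtain ⟨H, hH⟩ := exists_forall_subset_box 2 α.support.toFinset
  have hαH : ∀ z ∈ α.support, z ∈ box 2 H := fun z hz => hH H le_rfl (List.mem_toFinset.2 hz)
  obtain ⟨w, hwB, hwH⟩ := exists_mem_siteCluster_not_mem_box hB H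
  obtain ⟨β, hβ⟩ := exists_walk_in_siteCluster hc hwB
  set α' : zdStarGraph.Walk (mkSite t₁ 0) (mkSite t₂ 0) :=
    (α.map (starReflectHom 1)).copy (Rf_mkSite_zero t₁) (Rf_mkSite_zero t₂) with hα'
  have hα'supp : ∀ z ∈ α'.support, ∃ y ∈ α.support, z = Rf y := fun z hz => by
    rw [hα', Walk.support_copy] at hz
    exact mem_support_map_starReflect α z hz
  obtain ⟨z, hzβ, hz⟩ := exists_mem_support_of_semicircuits (m := 0) (c₁ := c) (c₂ := c) h1 h2
    (mkSite_apply_zero t₁ 0) (mkSite_apply_one t₁ 0) (mkSite_apply_zero t₂ 0) (mkSite_apply_one t₂ 0)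
    α (fun z hz => ⟨hAup (hα z hz), fun ⟨h0, h0', h1'⟩ => hdisj z (hα z hz) (by
      have hz1 : z 1 = 0 := le_antisymm h1' (hAup (hα z hz))
      rw [eq_mkSite_of_axis hz1, show z 0 = c by omega]; exact hc)⟩)
    α' (fun z hz => by
      obtain ⟨y, hy, rfl⟩ := hα'supp z hz
      have hy1 : 0 ≤ y 1 := hAup (hα y hy)
      refine ⟨by rw [Rf_apply_one]; omega, fun ⟨h0, h0', h1'⟩ => hdisj y (hα y hy) ?_⟩
      rw [Rf_apply_one] at h1'
      have hy1' : y 1 = 0 := by omega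
      rw [Rf_apply_zero] at h0 h0'
      rw [eq_mkSite_of_axis hy1', show y 0 = c by omega]; exact hc)
    hαH (fun z hz => by
      obtain ⟨y, hy, rfl⟩ := hα'supp z hz
      exact mem_box_Rf_iff.2 (hαH y hy))
    (u := mkSite c 0) ⟨le_rfl, le_rfl, le_rfl, le_rfl⟩ hwH β
  rcases hz with hz | hz
  · exact hdisj z (hα z hz) (hβ z hzβ)
  · obtain ⟨y, hy, rfl⟩ := hα'supp z hz
    have hy1 : 0 ≤ y 1 := hAup (hα y hy)
    have hRy1 : 0 ≤ Rf y 1 := hO (mem_of_mem_siteCluster (hβ _ hzβ))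
    rw [Rf_apply_one] at hRy1
    have : Rf y = y := by
      ext i; fin_cases i
      · exact Rf_apply_zero y
      · change Rf y 1 = y 1; rw [Rf_apply_one]; omega
    rw [this] at hzβ
    exact hdisj y (hα y hy) (hβ y hzβ)

/-- **Same-colour `∗`clusters do not interleave**: for two disjoint `∗`clusters of sites of `π_up`
with the same open set, the second one infinite, no axis site of the second lies strictly between
two axis sites of the first (a `∗`-walk squeezing through a `∗`arc is `∗`-adjacent to it). [cite: GeorgiiHiguchi2000, Lemma 4.1 (proof)] -/
theorem not_between_of_sameStar {O : Set (Site 2)} (hO : O ⊆ halfPlane 0) {x₁ x₂ : Site 2}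
    (hD₂ : (siteCluster zdStarGraph O x₂).Infinite)
    (hdisj : ∀ z ∈ siteCluster zdStarGraph O x₁, z ∉ siteCluster zdStarGraph O x₂)
    {t₁ t₂ c : ℤ} (ht₁ : mkSite t₁ 0 ∈ siteCluster zdStarGraph O x₁) (ht₂ : mkSite t₂ 0 ∈ siteCluster zdStarGraph O x₁)
    (hc : mkSite c 0 ∈ siteCluster zdStarGraph O x₂) (h1 : t₁ < c) (h2 : c < t₂) : False := by
  classical
  set D₁ := siteCluster zdStarGraph O x₁
  set D₂ := siteCluster zdStarGraph O x₂
  obtain ⟨α, hα⟩ := exists_walk_in_siteCluster ht₁ ht₂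
  obtain ⟨H, hH⟩ := exists_forall_subset_box 2 α.support.toFinset
  have hαH : ∀ z ∈ α.support, z ∈ box 2 H := fun z hz => hH H le_rfl (List.mem_toFinset.2 hz)
  obtain ⟨w, hwB, hwH⟩ := exists_mem_siteCluster_not_mem_box hD₂ H
  obtain ⟨β, hβ⟩ := exists_walk_in_siteCluster hc hwB
  set α' : zdStarGraph.Walk (mkSite t₁ 0) (mkSite t₂ 0) :=
    (α.map (starReflectHom 1)).copy (Rf_mkSite_zero t₁) (Rf_mkSite_zero t₂) with hα'
  have hα'supp : ∀ z ∈ α'.support, ∃ y ∈ α.support, z = Rf y := fun z hz => by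
    rw [hα', Walk.support_copy] at hz
    exact mem_support_map_starReflect α z hz
  -- joining: a site of `D₁` equal or `∗`-adjacent to a site of `D₂` merges the clusters
  have hjoin : ∀ y ∈ D₁, ∀ z' ∈ D₂, ¬ (y = z' ∨ zdStarGraph.Adj y z') := by
    rintro y hy z' hz' (rfl | hadj)
    · exact hdisj y hy hz'
    · exact hdisj z' (mem_siteCluster_of_adj hy (mem_of_mem_siteCluster hz') hadj) hz'
  obtain ⟨z, hz, z', hz'β, hzz'⟩ := exists_touch_of_bandSemicircuits (m := 0) (c₁ := c) (c₂ := c) h1 h2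
    (mkSite_apply_zero t₁ 0) (mkSite_apply_one t₁ 0) (mkSite_apply_zero t₂ 0) (mkSite_apply_one t₂ 0)
    α (fun z hz ⟨h0, h0', h1'⟩ => hdisj z (hα z hz) (by
      have hz1 : z 1 = 0 := le_antisymm h1' (hO (mem_of_mem_siteCluster (hα z hz)))
      rw [eq_mkSite_of_axis hz1, show z 0 = c by omega]; exact hc))
    α' (fun z hz ⟨h0, h0', h1'⟩ => by
      obtain ⟨y, hy, rfl⟩ := hα'supp z hz
      have hy1 : 0 ≤ y 1 := hO (mem_of_mem_siteCluster (hα y hy))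
      rw [Rf_apply_one] at h1'
      rw [Rf_apply_zero] at h0 h0'
      have hy1' : y 1 = 0 := by omega
      exact hdisj y (hα y hy) (by rw [eq_mkSite_of_axis hy1', show y 0 = c by omega]; exact hc))
    hαH (fun z hz => by
      obtain ⟨y, hy, rfl⟩ := hα'supp z hz
      exact mem_box_Rf_iff.2 (hαH y hy))
    (u := mkSite c 0) ⟨le_rfl, le_rfl, le_rfl, le_rfl⟩ hwH β
  have hz'D₂ : z' ∈ D₂ := hβ z' hz'β
  have hz'1 : 0 ≤ z' 1 := hO (mem_of_mem_siteCluster hz'D₂)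
  rcases hz with hz | hz
  · exact hjoin z (hα z hz) z' hz'D₂ (hzz'.imp id fun h => zdGraph_le_zdStarGraph h)
  · obtain ⟨y, hy, rfl⟩ := hα'supp z hz
    have hyD₁ : y ∈ D₁ := hα y hy
    have hy1 : 0 ≤ y 1 := hO (mem_of_mem_siteCluster hyD₁)
    -- `Rf y` (row `≤ 0`) equal or lattice-adjacent to `z'` (row `≥ 0`): then `y` itself is `∗`-adjacent or equal
    refine hjoin y hyD₁ z' hz'D₂ ?_
    rcases hzz' with h | h
    · left
      have : y 1 = 0 := by have := congrArg (· 1) h; simp only [Rf_apply_one] at this; omega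
      rw [← h]; ext i; fin_cases i
      · exact (Rf_apply_zero y).symm
      · change y 1 = Rf y 1; rw [Rf_apply_one]; omega
    · right
      rw [zdStarGraph_adj_iff]
      rcases (zdGraph_two_adj_iff _ _).1 h with ⟨h0, h1⟩ | ⟨h0, h1⟩ | ⟨h1, h0⟩ | ⟨h1, h0⟩ <;>
        rw [Rf_apply_zero] at h0 <;> rw [Rf_apply_one] at h1 <;>
        refine ⟨?_, by rw [abs_le]; omega, by rw [abs_le]; omega⟩ <;> omega

/-! ### Combinatorics of non-interleaving traces -/

/-- If `T` is unbounded below and no point of `S` lies strictly between two points of `T`, then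
every point of `S` is `≥` every point of `T`. [folklore] -/
theorem not_lt_of_unbounded_below {T S : Set ℤ} (hT : ∀ N : ℤ, ∃ t ∈ T, t < N)
    (hno : ∀ t₁ ∈ T, ∀ t₂ ∈ T, ∀ s ∈ S, ¬ (t₁ < s ∧ s < t₂)) {s t : ℤ} (hs : s ∈ S)
    (ht : t ∈ T) : ¬ s < t := by
  intro hst
  obtain ⟨t₁, ht₁, hlt⟩ := hT s
  exact hno t₁ ht₁ t ht s hs ⟨hlt, hst⟩

/-- Symmetric version: `T` unbounded above. [folklore] -/
theorem not_gt_of_unbounded_above {T S : Set ℤ} (hT : ∀ N : ℤ, ∃ t ∈ T, N < t)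
    (hno : ∀ t₁ ∈ T, ∀ t₂ ∈ T, ∀ s ∈ S, ¬ (t₁ < s ∧ s < t₂)) {s t : ℤ} (hs : s ∈ S)
    (ht : t ∈ T) : ¬ t < s := by
  intro hst
  obtain ⟨t₂, ht₂, hlt⟩ := hT s
  exact hno t ht t₂ ht₂ s hs ⟨hst, hlt⟩

/-- A set of integers unbounded in modulus is unbounded below or unbounded above. [folklore] -/
theorem unbounded_below_or_above {T : Set ℤ} (hT : ∀ n : ℕ, ∃ t ∈ T, (n : ℤ) < |t|) :
    (∀ N : ℤ, ∃ t ∈ T, t < N) ∨ (∀ N : ℤ, ∃ t ∈ T, N < t) := by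
  by_contra h
  rw [not_or] at h
  push Not at h
  obtain ⟨⟨N₁, hN₁⟩, ⟨N₂, hN₂⟩⟩ := h
  obtain ⟨t, ht, hbig⟩ := hT (N₁.natAbs + N₂.natAbs)
  have h1 := hN₁ t ht; have h2 := hN₂ t ht
  push_cast at hbig
  rw [lt_abs] at hbig
  rcases abs_cases N₁ with ⟨ha, _⟩ | ⟨ha, _⟩ <;> rcases abs_cases N₂ with ⟨hb, _⟩ | ⟨hb, _⟩ <;>
    rw [ha, hb] at hbig <;> omega

/-! ### Visibility: symmetry and far sites -/

section Visibility

variable {C : Finset (Site 2)} {x₀ : Site 2}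

/-- For a reflection-symmetric `C` and a base point on the axis, `LVis` is symmetric. [folklore] -/
theorem Rf_mem_LVis_of_symm (hC : ∀ z, z ∈ C ↔ Rf z ∈ C) (hx₀ : Rf x₀ = x₀) {y : Site 2}
    (hy : y ∈ LVis C x₀) : Rf y ∈ LVis C x₀ := by
  obtain ⟨hyC, ⟨c, hc, hyc⟩, w, hw⟩ := hy
  refine ⟨fun h => hyC ((hC y).2 h), ⟨Rf c, (hC c).1 hc, (reflectCoord (d := 2) 1).map_rel_iff.2 hyc⟩,
    (w.map (reflectCoord (d := 2) 1).toHom).copy hx₀ rfl, fun v hv => ?_⟩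
  rw [Walk.support_copy] at hv
  obtain ⟨u, hu, rfl⟩ := (mem_support_map_iff' _ w v).1 hv
  exact fun h => hw u hu ((hC u).2 h)

/-- For a reflection-symmetric `C` and a base point on the axis, `LOutVis` is symmetric. [folklore] -/
theorem Rf_mem_LOutVis_of_symm (hC : ∀ z, z ∈ C ↔ Rf z ∈ C) (hx₀ : Rf x₀ = x₀) {y : Site 2}
    (hy : y ∈ LOutVis C x₀) : Rf y ∈ LOutVis C x₀ := by
  obtain ⟨hyV, w, hwC, hwV⟩ := hy
  refine ⟨Rf_mem_LVis_of_symm hC hx₀ hyV, (w.map (reflectCoord (d := 2) 1).toHom).copy hx₀ rfl,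
    fun v hv => ?_, fun v hv hvy => ?_⟩
  · rw [Walk.support_copy] at hv
    obtain ⟨u, hu, rfl⟩ := (mem_support_map_iff' _ w v).1 hv
    exact fun h => hwC u hu ((hC u).2 h)
  · rw [Walk.support_copy] at hv
    obtain ⟨u, hu, rfl⟩ := (mem_support_map_iff' _ w v).1 hv
    intro h
    have hu' : u ≠ y := fun e => hvy (by rw [e]; rfl)
    exact hwV u hu hu' (by simpa [Rf_Rf] using Rf_mem_LVis_of_symm hC hx₀ h)

/-- A site with a coordinate of modulus `≥ N + 2` is not adjacent to `Λ_N`. [folklore] -/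
theorem not_adj_of_far {N : ℕ} {r c : Site 2} (hr : ∃ i, (N : ℤ) + 2 ≤ |r i|) (hc : c ∈ box 2 N) :
    ¬ (zdGraph 2).Adj r c := by
  intro h
  obtain ⟨i, hi⟩ := hr
  rw [mem_box, Fin.forall_fin_two] at hc
  rw [le_abs] at hi
  rcases (zdGraph_two_adj_iff r c).1 h with ⟨h0, h1⟩ | ⟨h0, h1⟩ | ⟨h1, h0⟩ | ⟨h1, h0⟩ <;>
    fin_cases i <;> simp at hi <;> omega

/-- A ring site of `{‖x‖_∞ = N + 3}` is far. [folklore] -/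
theorem far_of_onRing {N : ℕ} {r : Site 2} (hr : OnRing (N + 3) r) : ∃ i, (N : ℤ) + 2 ≤ |r i| := by
  rcases hr with ⟨h, -⟩ | ⟨h, -⟩
  · exact ⟨0, by rw [h]; push_cast; omega⟩
  · exact ⟨1, by rw [h]; push_cast; omega⟩

/-- **The approach ray**: a site on the ring `{‖x‖_∞ = N+1}` is reached from the ring
`{‖x‖_∞ = N+3}` in two lattice steps through a far site. [folklore] -/
theorem exists_approach {N : ℕ} {f : Site 2} (hf : OnRing (N + 1) f) :
    ∃ r mid : Site 2, OnRing (N + 3) r ∧ (zdGraph 2).Adj r mid ∧ (zdGraph 2).Adj mid f ∧ ∃ i, (N : ℤ) + 2 ≤ |mid i| := by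
  rcases hf with ⟨hf0, hf1⟩ | ⟨hf1, hf0⟩
  · rcases (abs_eq (by positivity : (0 : ℤ) ≤ (N + 1 : ℕ))).1 hf0 with h | h
    · refine ⟨f + Pi.single 0 1 + Pi.single 0 1, f + Pi.single 0 1, ?_, (Zhang.adj_add_unitStep.1 _).symm,
        (Zhang.adj_add_unitStep.1 _).symm, 0, ?_⟩
      · left; simp; push_cast at h hf1 ⊢; constructor <;> [rw [abs_eq (by positivity)]; rw [abs_le] at hf1 ⊢] <;> omega
      · simp; push_cast at h ⊢; rw [le_abs]; omega
    · refine ⟨f + -Pi.single 0 1 + -Pi.single 0 1, f + -Pi.single 0 1, ?_, (Zhang.adj_add_unitStep.2.1 _).symm,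
        (Zhang.adj_add_unitStep.2.1 _).symm, 0, ?_⟩
      · left; simp; push_cast at h hf1 ⊢; constructor <;> [rw [abs_eq (by positivity)]; rw [abs_le] at hf1 ⊢] <;> omega
      · simp; push_cast at h ⊢; rw [le_abs]; omega
  · rcases (abs_eq (by positivity : (0 : ℤ) ≤ (N + 1 : ℕ))).1 hf1 with h | h
    · refine ⟨f + Pi.single 1 1 + Pi.single 1 1, f + Pi.single 1 1, ?_, (Zhang.adj_add_unitStep.2.2.1 _).symm,
        (Zhang.adj_add_unitStep.2.2.1 _).symm, 1, ?_⟩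
      · right; simp; push_cast at h hf0 ⊢; constructor <;> [rw [abs_eq (by positivity)]; rw [abs_le] at hf0 ⊢] <;> omega
      · simp; push_cast at h ⊢; rw [le_abs]; omega
    · refine ⟨f + -Pi.single 1 1 + -Pi.single 1 1, f + -Pi.single 1 1, ?_, (Zhang.adj_add_unitStep.2.2.2 _).symm,
        (Zhang.adj_add_unitStep.2.2.2 _).symm, 1, ?_⟩
      · right; simp; push_cast at h hf0 ⊢; constructor <;> [rw [abs_eq (by positivity)]; rw [abs_le] at hf0 ⊢] <;> omega
      · simp; push_cast at h ⊢; rw [le_abs]; omega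

end Visibility

/-! ### The separating dual `∗`-walk between two lattice clusters -/

section Separation

variable {O : Set (Site 2)} {xL xR : Site 2}

/-- The truncation: the lattice-component of the axis site `(t, 0)` in `C_L ∩ Λ_N`. [folklore] -/
def trunc (O : Set (Site 2)) (xL : Site 2) (t : ℤ) (N : ℕ) : Set (Site 2) :=
  {z | z ∈ box 2 N ∧ ∃ w : (zdGraph 2).Walk z (mkSite t 0), ∀ v ∈ w.support, v ∈ box 2 N ∧ v ∈ siteCluster (zdGraph 2) O xL}

/-- The symmetrised truncation as a finite set. [folklore] -/
def truncSym (O : Set (Site 2)) (xL : Site 2) (t : ℤ) (N : ℕ) : Finset (Site 2) := by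
  classical exact (box 2 N).filter fun z => z ∈ trunc O xL t N ∨ Rf z ∈ trunc O xL t N

variable {t : ℤ} {N : ℕ}

/-- Membership in the symmetrised truncation. [folklore] -/
theorem mem_truncSym_iff {z : Site 2} : z ∈ truncSym O xL t N ↔ z ∈ trunc O xL t N ∨ Rf z ∈ trunc O xL t N := by
  classical
  unfold truncSym
  rw [mem_filter, and_iff_right_iff_imp]
  rintro (h | h)
  · exact h.1
  · exact mem_box_Rf_iff.1 h.1

/-- The truncation consists of sites of the cluster. [folklore] -/
theorem mem_cluster_of_mem_trunc {z : Site 2} (hz : z ∈ trunc O xL t N) : z ∈ siteCluster (zdGraph 2) O xL :=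
  let ⟨_, w, hw⟩ := hz; (hw z (Walk.start_mem_support w)).2

/-- The truncation is lattice-connected through itself. [folklore] -/
theorem exists_walk_trunc {z : Site 2} (hz : z ∈ trunc O xL t N) :
    ∃ w : (zdGraph 2).Walk z (mkSite t 0), ∀ v ∈ w.support, v ∈ trunc O xL t N := by
  obtain ⟨-, w, hw⟩ := hz
  exact ⟨w, fun v hv => ⟨(hw v hv).1, w.dropUntil v hv, fun u hu => hw u (Walk.support_dropUntil_subset_support w hv hu)⟩⟩

/-- A cluster neighbour in the box of a truncation site is a truncation site. [folklore] -/
theorem mem_trunc_of_adj {y c : Site 2} (hy : y ∈ box 2 N) (hyC : y ∈ siteCluster (zdGraph 2) O xL)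
    (hyc : (zdGraph 2).Adj y c) (hc : c ∈ trunc O xL t N) : y ∈ trunc O xL t N := by
  obtain ⟨-, w, hw⟩ := hc
  refine ⟨hy, Walk.cons hyc w, fun v hv => ?_⟩
  rw [Walk.support_cons, List.mem_cons] at hv
  rcases hv with rfl | hv
  · exact ⟨hy, hyC⟩
  · exact hw v hv

/-- The symmetrised truncation is symmetric. [folklore] -/
theorem mem_truncSym_Rf_iff {z : Site 2} : Rf z ∈ truncSym O xL t N ↔ z ∈ truncSym O xL t N := by
  rw [mem_truncSym_iff, mem_truncSym_iff, Rf_Rf, or_comm]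

/-- Symmetrised truncation sites lie in the box. [folklore] -/
theorem mem_box_of_mem_truncSym {z : Site 2} (hz : z ∈ truncSym O xL t N) : z ∈ box 2 N := by
  rcases mem_truncSym_iff.1 hz with h | h
  · exact h.1
  · exact mem_box_Rf_iff.1 h.1

/-- **Key adjacency fact**: a site of the closed upper half-plane adjacent to the symmetrised
truncation is adjacent to a truncation site (a site of `C_L`). [folklore] -/
theorem exists_adj_trunc_of_adj_truncSym (hO : O ⊆ halfPlane 0) {v c : Site 2} (hv : 0 ≤ v 1)
    (hc : c ∈ truncSym O xL t N) (hvc : (zdGraph 2).Adj v c) : ∃ c' ∈ trunc O xL t N, (zdGraph 2).Adj v c' := by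
  rcases mem_truncSym_iff.1 hc with h | h
  · exact ⟨c, h, hvc⟩
  · have hRc1 : 0 ≤ Rf c 1 := hO (mem_of_mem_siteCluster (mem_cluster_of_mem_trunc h))
    rw [Rf_apply_one] at hRc1
    rcases (zdGraph_two_adj_iff v c).1 hvc with ⟨h0, h1⟩ | ⟨h0, h1⟩ | ⟨h1, h0⟩ | ⟨h1, h0⟩
    · -- horizontal: same row, so `c 1 = 0` and `Rf c = c`
      have hc1 : c 1 = 0 := by omega
      have : Rf c = c := by
        ext i; fin_cases i
        · exact Rf_apply_zero c
        · change Rf c 1 = c 1; rw [Rf_apply_one, hc1]; simp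
      exact ⟨c, this ▸ h, hvc⟩
    · have hc1 : c 1 = 0 := by omega
      have : Rf c = c := by
        ext i; fin_cases i
        · exact Rf_apply_zero c
        · change Rf c 1 = c 1; rw [Rf_apply_one, hc1]; simp
      exact ⟨c, this ▸ h, hvc⟩
    · -- `c` above `v`: `c 1 = v 1 + 1 ≥ 1` contradicts `c 1 ≤ 0`
      exfalso; omega
    · -- `c` below `v`: either `c` on the axis (`Rf c = c`), or `v 1 = 0`, `c 1 = -1` and `Rf c = (c 0, 1)` is adjacent to `v`
      by_cases hc1 : c 1 = 0
      · have : Rf c = c := by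
          ext i; fin_cases i
          · exact Rf_apply_zero c
          · change Rf c 1 = c 1; rw [Rf_apply_one, hc1]; simp
        exact ⟨c, this ▸ h, hvc⟩
      have hv1 : v 1 = 0 := by omega
      refine ⟨Rf c, h, adj_of_stepKind (.up ?_ ?_)⟩
      · show Rf c 1 = v 1 + 1
        rw [Rf_apply_one]; omega
      · show Rf c 0 = v 0
        rw [Rf_apply_zero]; exact h0

/-- A site of `O` in the upper half-plane adjacent to the symmetrised truncation belongs to `C_L`,
and, if it lies in the box, to the truncation. [folklore] -/
theorem mem_trunc_of_adj_truncSym (hO : O ⊆ halfPlane 0) {v c : Site 2} (hvO : v ∈ O)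
    (hc : c ∈ truncSym O xL t N) (hvc : (zdGraph 2).Adj v c) :
    v ∈ siteCluster (zdGraph 2) O xL ∧ (v ∈ box 2 N → v ∈ trunc O xL t N) := by
  obtain ⟨c', hc', hvc'⟩ := exists_adj_trunc_of_adj_truncSym hO (hO hvO) hc hvc
  have hvC : v ∈ siteCluster (zdGraph 2) O xL := mem_siteCluster_of_adj (mem_cluster_of_mem_trunc hc') hvO hvc'.symm
  exact ⟨hvC, fun hvN => mem_trunc_of_adj hvN hvC hvc' hc'⟩

/-- The symmetrised truncation is lattice-connected. [folklore] -/
theorem truncSym_connected : ∀ a ∈ truncSym O xL t N, ∀ b ∈ truncSym O xL t N,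
    ∃ q : (zdGraph 2).Walk a b, ∀ z ∈ q.support, z ∈ truncSym O xL t N := by
  -- every site is joined inside `truncSym` to the axis site `(t, 0)`
  have key : ∀ a ∈ truncSym O xL t N, ∃ q : (zdGraph 2).Walk a (mkSite t 0), ∀ z ∈ q.support, z ∈ truncSym O xL t N := by
    intro a ha
    rcases mem_truncSym_iff.1 ha with h | h
    · obtain ⟨w, hw⟩ := exists_walk_trunc h
      exact ⟨w, fun z hz => mem_truncSym_iff.2 (Or.inl (hw z hz))⟩
    · obtain ⟨w, hw⟩ := exists_walk_trunc h
      refine ⟨(w.map (reflectCoord (d := 2) 1).toHom).copy (Rf_Rf a) (Rf_mkSite_zero t), fun z hz => ?_⟩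
      rw [Walk.support_copy] at hz
      obtain ⟨u, hu, rfl⟩ := (mem_support_map_iff' _ w z).1 hz
      exact mem_truncSym_Rf_iff.2 (mem_truncSym_iff.2 (Or.inl (hw u hu)))
  intro a ha b hb
  obtain ⟨q₁, hq₁⟩ := key a ha
  obtain ⟨q₂, hq₂⟩ := key b hb
  refine ⟨q₁.append q₂.reverse, fun z hz => ?_⟩
  rw [Walk.mem_support_append_iff, Walk.support_reverse, List.mem_reverse] at hz
  rcases hz with hz | hz
  · exact hq₁ z hz
  · exact hq₂ z hz

/-- **The separating dual `∗`-walk.** Let `C_L, C_R` be disjoint infinite lattice clusters of sites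
of `O ⊆ π_up`, with axis sites `(t₁, 0) ∈ C_L`, `(t₂, 0) ∈ C_R`, `t₁ < t₂`, both in `Λ_N`. Then some
axis site `(g, 0)`, `t₁ < g < t₂`, is joined to the border of `Λ_N` by a `∗`-walk of sites of
`π_up ∖ O` inside `Λ_N` (the boundary of the truncation of `C_L`, Deuschel–Pisztora/Timár, folded). [cite: GeorgiiHiguchi2000, Lemma 4.1 (proof)] -/
theorem exists_dual_starWalk_between (hO : O ⊆ halfPlane 0)
    (hL : (siteCluster (zdGraph 2) O xL).Infinite) (hR : (siteCluster (zdGraph 2) O xR).Infinite)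
    (hdisj : ∀ z ∈ siteCluster (zdGraph 2) O xL, z ∉ siteCluster (zdGraph 2) O xR)
    {t₁ t₂ : ℤ} (ht₁ : mkSite t₁ 0 ∈ siteCluster (zdGraph 2) O xL) (ht₂ : mkSite t₂ 0 ∈ siteCluster (zdGraph 2) O xR)
    (h12 : t₁ < t₂) {N : ℕ} (hN₁ : mkSite t₁ 0 ∈ box 2 N) (hN₂ : mkSite t₂ 0 ∈ box 2 N) :
    ∃ (g : ℤ) (v : Site 2) (q : zdStarGraph.Walk (mkSite g 0) v), t₁ < g ∧ g < t₂ ∧ (∃ i, |v i| = N) ∧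
      ∀ z ∈ q.support, z ∈ box 2 N ∧ 0 ≤ z 1 ∧ z ∉ O := by
  classical
  set CL := siteCluster (zdGraph 2) O xL with hCL
  set CR := siteCluster (zdGraph 2) O xR with hCR
  set C := truncSym O xL t₁ N with hC
  set x₀ := mkSite t₂ 0 with hx₀
  have ht₁T : mkSite t₁ 0 ∈ trunc O xL t₁ N := ⟨hN₁, Walk.nil, fun v hv => by
    rw [Walk.support_nil, List.mem_singleton] at hv; exact hv ▸ ⟨hN₁, ht₁⟩⟩
  have hCsym : ∀ z, z ∈ C ↔ Rf z ∈ C := fun z => mem_truncSym_Rf_iff.symm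
  have hx₀R : Rf x₀ = x₀ := Rf_mkSite_zero t₂
  -- sites of `C_R` are neither in `C` nor adjacent to it
  have hRnotC : ∀ v ∈ CR, v ∉ C := by
    intro v hv hvC
    rcases mem_truncSym_iff.1 hvC with h | h
    · exact hdisj v (mem_cluster_of_mem_trunc h) hv
    · have hRv1 : 0 ≤ Rf v 1 := hO (mem_of_mem_siteCluster (mem_cluster_of_mem_trunc h))
      have hv1 : 0 ≤ v 1 := hO (mem_of_mem_siteCluster hv)
      rw [Rf_apply_one] at hRv1
      have : Rf v = v := by
        ext i; fin_cases i
        · exact Rf_apply_zero v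
        · change Rf v 1 = v 1; rw [Rf_apply_one]; omega
      rw [this] at h
      exact hdisj v (mem_cluster_of_mem_trunc h) hv
  have hRnotadj : ∀ v ∈ CR, ∀ c ∈ C, ¬ (zdGraph 2).Adj v c := fun v hv c hc hvc =>
    hdisj v (mem_trunc_of_adj_truncSym hO (mem_of_mem_siteCluster hv) hc hvc).1 hv
  have hx₀C : x₀ ∉ C := hRnotC x₀ ht₂
  have hx₀adj : ∀ c ∈ C, ¬ (zdGraph 2).Adj x₀ c := hRnotadj x₀ ht₂
  -- (d) a visible axis site strictly between `t₁` and `t₂`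
  obtain ⟨zn, hzn, hzn1, hzn0⟩ : ∃ zn ∈ LOutVis C x₀, zn 1 = 0 ∧ t₁ < zn 0 ∧ zn 0 < t₂ := by
    set k : ℕ := (t₂ - t₁).toNat with hk
    have hk' : (k : ℤ) = t₂ - t₁ := by rw [hk, Int.toNat_of_nonneg (by omega)]
    have hend : (fun w : Site 2 => w + -Pi.single 0 1)^[k] x₀ = mkSite t₁ 0 := by
      ext i; fin_cases i
      · change ((fun w : Site 2 => w + -Pi.single 0 1)^[k] x₀) 0 = t₁
        rw [(iterate_left_apply x₀ k).1, hk', hx₀, mkSite_apply_zero]; ring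
      · change ((fun w : Site 2 => w + -Pi.single 0 1)^[k] x₀) 1 = 0
        rw [(iterate_left_apply x₀ k).2, hx₀, mkSite_apply_one]
    have hcC : (fun w : Site 2 => w + -Pi.single 0 1)^[k] x₀ ∈ C := by
      rw [hend]; exact mem_truncSym_iff.2 (Or.inl ht₁T)
    obtain ⟨z, hzw, hzV, -⟩ := exists_mem_LOutVis_of_walk (C := C) (x₀ := x₀) hx₀C hcC
      (Zhang.stepRun (-Pi.single 0 1) Zhang.adj_add_unitStep.2.1 x₀ k)
    rw [mem_support_leftRun] at hzw
    obtain ⟨hz0, hz0', hz1⟩ := hzw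
    rw [hx₀, mkSite_apply_zero] at hz0 hz0'
    rw [hx₀, mkSite_apply_one] at hz1
    refine ⟨z, hzV, hz1, ?_, ?_⟩
    · -- `z ≠ (t₁, 0)` since `z ∉ C`
      rcases lt_or_eq_of_le (show t₁ ≤ z 0 by rw [hk'] at hz0; linarith) with h | h
      · exact h
      · exfalso; apply hzV.1.1
        rw [eq_mkSite_of_axis hz1, ← h]; exact mem_truncSym_iff.2 (Or.inl ht₁T)
    · rcases lt_or_eq_of_le hz0' with h | h
      · exact h
      · exfalso
        obtain ⟨c, hc, hzc⟩ := hzV.1.2.1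
        have : z = x₀ := by rw [eq_mkSite_of_axis hz1, h]
        exact hx₀adj c hc (this ▸ hzc)
  -- (e) the exit point `f` of `C_L` from `Λ_N`
  obtain ⟨wL, hwL, hwLN⟩ := exists_mem_siteCluster_not_mem_box hL N
  obtain ⟨pL, hpL⟩ := exists_walk_in_siteCluster ht₁ hwL
  obtain ⟨b, f, W₀, hbf, hfN, hfpL, hW₀N, hW₀pL⟩ := exists_split_first_mem' (S := ((↑(box 2 N) : Set (Site 2))ᶜ)) pL
    (fun h => h (Finset.mem_coe.2 hN₁)) ⟨wL, Walk.end_mem_support pL, fun h => hwLN (Finset.mem_coe.1 h)⟩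
  have hfN' : f ∉ box 2 N := fun h => hfN (Finset.mem_coe.2 h)
  have hW₀T : ∀ v ∈ W₀.support, v ∈ trunc O xL t₁ N := by
    intro v hv
    have hvN : v ∈ box 2 N := by
      by_contra h; exact hW₀N v hv (fun h' => h (Finset.mem_coe.1 h'))
    refine ⟨hvN, (W₀.takeUntil v hv).reverse, fun u hu => ?_⟩
    rw [Walk.support_reverse, List.mem_reverse] at hu
    have hu' : u ∈ W₀.support := Walk.support_takeUntil_subset_support W₀ hv hu
    exact ⟨by by_contra h; exact hW₀N u hu' (fun h' => h (Finset.mem_coe.1 h')), hpL u (hW₀pL u hu')⟩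
  have hbT : b ∈ trunc O xL t₁ N := hW₀T b (Walk.end_mem_support W₀)
  have hbC : b ∈ C := mem_truncSym_iff.2 (Or.inl hbT)
  have hfCL : f ∈ CL := hpL f hfpL
  have hfring : OnRing (N + 1) f := onRing_of_adj_not_mem_box hbT.1 hbf hfN'
  -- the visibility walk to `f`: through `C_R` to the ring `{‖·‖ = N+3}`, along the ring, down the ray
  obtain ⟨wR, hwR, hwRN⟩ := exists_mem_siteCluster_not_mem_box hR (N + 2)
  obtain ⟨pR, hpR⟩ := exists_walk_in_siteCluster ht₂ hwR
  obtain ⟨b', r₁, W₁, hb'r₁, hr₁N, hr₁pR, hW₁N, hW₁pR⟩ := exists_split_first_mem' (S := ((↑(box 2 (N + 2)) : Set (Site 2))ᶜ)) pR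
    (fun h => h (Finset.mem_coe.2 (box_mono 2 (by omega) hN₂))) ⟨wR, Walk.end_mem_support pR, fun h => hwRN (Finset.mem_coe.1 h)⟩
  have hr₁ring : OnRing (N + 3) r₁ :=
    onRing_of_adj_not_mem_box (by by_contra h; exact hW₁N b' (Walk.end_mem_support W₁) (fun h' => h (Finset.mem_coe.1 h'))) hb'r₁
      (fun h => hr₁N (Finset.mem_coe.2 h))
  obtain ⟨r₂, mid, hr₂ring, hr₂mid, hmidf, hmidfar⟩ := exists_approach hfring
  obtain ⟨qring, hqring⟩ := exists_walk_onRing hr₁ring hr₂ring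
  have hCbox : ∀ c ∈ C, c ∈ box 2 N := fun c hc => mem_box_of_mem_truncSym hc
  let vis : (zdGraph 2).Walk x₀ f :=
    (W₁.append (Walk.cons hb'r₁ qring)).append (Walk.cons hr₂mid (Walk.cons hmidf Walk.nil))
  have hvis : ∀ v ∈ vis.support, v = f ∨ v ∈ CR ∨ (∃ i, (N : ℤ) + 2 ≤ |v i|) := by
    intro v hv
    simp only [vis, Walk.mem_support_append_iff, Walk.support_cons, Walk.support_nil, List.mem_cons,
      List.not_mem_nil, or_false] at hv
    rcases hv with (hv | hv | hv) | hv | hv | hv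
    · exact Or.inr (Or.inl (hpR v (hW₁pR v hv)))
    · exact Or.inr (Or.inl (hv ▸ hpR b' (hW₁pR b' (Walk.end_mem_support W₁))))
    · exact Or.inr (Or.inr (far_of_onRing (hqring v hv)))
    · exact Or.inr (Or.inr (hv ▸ far_of_onRing hr₂ring))
    · exact Or.inr (Or.inr (hv ▸ hmidfar))
    · exact Or.inl hv
  have hfC : f ∉ C := fun h => hfN' (hCbox f h)
  have hfV : f ∈ LVis C x₀ := by
    refine ⟨hfC, ⟨b, hbC, hbf.symm⟩, vis, fun v hv hvC => ?_⟩
    rcases hvis v hv with rfl | hv | hv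
    · exact hfC hvC
    · exact hRnotC v hv hvC
    · obtain ⟨i, hi⟩ := hv
      have := mem_box.1 (hCbox v hvC) i
      rw [le_abs] at hi; omega
  have hfOut : f ∈ LOutVis C x₀ := by
    refine ⟨hfV, vis, fun v hv hvC => ?_, fun v hv hvf hvV => ?_⟩
    · rcases hvis v hv with rfl | hv | hv
      · exact hfC hvC
      · exact hRnotC v hv hvC
      · obtain ⟨i, hi⟩ := hv
        have := mem_box.1 (hCbox v hvC) i
        rw [le_abs] at hi; omega
    · obtain ⟨-, ⟨c, hc, hvc⟩, -⟩ := hvV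
      rcases hvis v hv with rfl | hv | hv
      · exact hvf rfl
      · exact hRnotadj v hv c hc hvc
      · exact not_adj_of_far hv (hCbox c hc) hvc
  -- (f) the Deuschel–Pisztora `∗`-walk, folded
  obtain ⟨q, hq⟩ := exists_starWalk_latticeBoundary (C := C) (x₀ := x₀) truncSym_connected hx₀C hx₀adj hzn hfOut
  have hVprop : ∀ y ∈ LOutVis C x₀, 0 ≤ y 1 → y ∈ box 2 N → y ∉ O := by
    intro y hy hy1 hyN hyO
    obtain ⟨⟨hyC, ⟨c, hc, hyc⟩, -⟩, -⟩ := hy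
    exact hyC (mem_truncSym_iff.2 (Or.inl ((mem_trunc_of_adj_truncSym hO hyO hc hyc).2 hyN)))
  set q' : zdStarGraph.Walk zn (foldSite f) := (q.map starFoldHom).copy (foldSite_of_nonneg hzn1.ge) rfl with hq'
  have hq'supp : ∀ z ∈ q'.support, z ∈ LOutVis C x₀ ∧ 0 ≤ z 1 := by
    intro z hz
    rw [hq', Walk.support_copy] at hz
    obtain ⟨y, hy, rfl⟩ := (mem_support_map_iff' _ q z).1 hz
    refine ⟨?_, by rw [starFoldHom_apply, foldSite_apply_one]; exact abs_nonneg _⟩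
    rw [starFoldHom_apply]
    rcases foldSite_eq_or y with h | h <;> rw [h]
    · exact hq y hy
    · exact Rf_mem_LOutVis_of_symm hCsym hx₀R (hq y hy)
  -- the prefix of `q'` inside `Λ_N`
  have hznN : zn ∈ box 2 N := by
    have h1 : -(N : ℤ) ≤ t₁ := by have := (mem_box.1 hN₁ 0).1; rwa [mkSite_apply_zero] at this
    have h2 : t₂ ≤ N := by have := (mem_box.1 hN₂ 0).2; rwa [hx₀, mkSite_apply_zero] at this
    rw [mem_box, Fin.forall_fin_two, hzn1]
    exact ⟨⟨by omega, by omega⟩, by omega, by omega⟩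
  have hfoldN : foldSite f ∉ box 2 N := fun h => hfN' (mem_box_foldSite_iff.1 h)
  obtain ⟨vin, g, P, hving, hgN, -, hPN, hPq'⟩ := exists_split_first_mem' (S := ((↑(box 2 N) : Set (Site 2))ᶜ)) q'
    (fun h => h (Finset.mem_coe.2 hznN)) ⟨foldSite f, Walk.end_mem_support q', fun h => hfoldN (Finset.mem_coe.1 h)⟩
  have hPbox : ∀ z ∈ P.support, z ∈ box 2 N := fun z hz => by
    by_contra h; exact hPN z hz (fun h' => h (Finset.mem_coe.1 h'))
  refine ⟨zn 0, vin, P.copy (eq_mkSite_of_axis hzn1) rfl, hzn0.1, hzn0.2, ?_, fun z hz => ?_⟩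
  · -- `vin ∈ Λ_N` is `∗`-adjacent to `g ∉ Λ_N`
    have hvN := mem_box.1 (hPbox vin (Walk.end_mem_support P))
    have hgN' : ¬ ∀ i, -(N : ℤ) ≤ g i ∧ g i ≤ N := fun h => hgN (Finset.mem_coe.2 (mem_box.2 h))
    rw [zdStarGraph_adj] at hving
    push Not at hgN'
    obtain ⟨i, hi⟩ := hgN'
    have h1 := hving.2 i; have h2 := hvN i
    rw [abs_le] at h1
    refine ⟨i, ?_⟩
    rw [abs_eq (by positivity)]
    by_cases h : -(N : ℤ) ≤ g i
    · have := hi h; omega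
    · omega
  · rw [Walk.support_copy] at hz
    have hz' := hq'supp z (hPq' z hz)
    exact ⟨hPbox z hz, hz'.2, hVprop z hz'.1 hz'.2 (hPbox z hz)⟩

end Separation

/-! ### Uniqueness of infinite lattice clusters -/

section LatticeUnique

variable {O : Set (Site 2)}

/-- Lattice clusters are `∗`-connected inside themselves. [folklore] -/
theorem starConn_of_latticeCluster {x : Site 2} :
    ∀ p ∈ siteCluster (zdGraph 2) O x, ∀ q ∈ siteCluster (zdGraph 2) O x,
      ∃ w : zdStarGraph.Walk p q, ∀ z ∈ w.support, z ∈ siteCluster (zdGraph 2) O x := by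
  intro p hp q hq
  obtain ⟨w, hw⟩ := exists_walk_in_siteCluster hp hq
  exact ⟨w.mapLe zdGraph_le_zdStarGraph, fun z hz => hw z (by rwa [Walk.support_mapLe_eq_support] at hz)⟩

/-- `∗`clusters are `∗`-connected inside themselves. [folklore] -/
theorem starConn_of_starCluster {U : Set (Site 2)} {x : Site 2} :
    ∀ p ∈ siteCluster zdStarGraph U x, ∀ q ∈ siteCluster zdStarGraph U x,
      ∃ w : zdStarGraph.Walk p q, ∀ z ∈ w.support, z ∈ siteCluster zdStarGraph U x :=
  fun _ hp _ hq => exists_walk_in_siteCluster hp hq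

/-- A walk of open sites is a walk of the open graph. [folklore] -/
theorem reachable_siteOpenGraph_of_walk {G : SimpleGraph (Site 2)} {u v : Site 2} (p : G.Walk u v)
    (hp : ∀ z ∈ p.support, z ∈ O) : (siteOpenGraph G O).Reachable u v := by
  induction p with
  | nil => exact Reachable.refl _
  | cons hadj p ih =>
    rename_i u' v' w'
    exact (Adj.reachable ((siteOpenGraph_adj _ _ _ _).2 ⟨hadj, hp u' (by simp), hp v' (by simp)⟩)).trans
      (ih fun z hz => hp z (by simp [hz]))

/-- A walk of open sites through a cluster site lies in the cluster. [folklore] -/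
theorem support_subset_cluster_of_mem {G : SimpleGraph (Site 2)} {x a b : Site 2} (w : G.Walk a b)
    (hw : ∀ z ∈ w.support, z ∈ O) {y : Site 2} (hy : y ∈ w.support) (hyC : y ∈ siteCluster G O x) :
    ∀ z ∈ w.support, z ∈ siteCluster G O x := by
  intro z hz
  have hay : (siteOpenGraph G O).Reachable a y :=
    reachable_siteOpenGraph_of_walk (w.takeUntil y hy) fun u hu => hw u (Walk.support_takeUntil_subset_support w hy hu)
  have haz : (siteOpenGraph G O).Reachable a z :=
    reachable_siteOpenGraph_of_walk (w.takeUntil z hz) fun u hu => hw u (Walk.support_takeUntil_subset_support w hz hu)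
  exact ⟨hyC.1, hw z hz, hyC.2.2.trans (hay.symm.trans haz)⟩

/-- **The ordered case is impossible**: two disjoint infinite lattice clusters of sites of `O ⊆ π_up`,
the first touching the axis unboundedly to the left and the second unboundedly to the right, when
every infinite `∗`cluster of `π_up ∖ O` touches the axis unboundedly. [cite: GeorgiiHiguchi2000, Lemma 4.1 (proof)] -/
theorem false_of_ordered_latticeClusters (hO : O ⊆ halfPlane 0)
    (hTs : ∀ x, (siteCluster zdStarGraph (halfPlane 0 \ O) x).Infinite → TouchesUnboundedly (siteCluster zdStarGraph (halfPlane 0 \ O) x))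
    {xL xR : Site 2} (hL : (siteCluster (zdGraph 2) O xL).Infinite) (hR : (siteCluster (zdGraph 2) O xR).Infinite)
    (hdisj : ∀ z ∈ siteCluster (zdGraph 2) O xL, z ∉ siteCluster (zdGraph 2) O xR)
    (hLb : ∀ N : ℤ, ∃ t ∈ axisTrace (siteCluster (zdGraph 2) O xL), t < N)
    (hRa : ∀ N : ℤ, ∃ t ∈ axisTrace (siteCluster (zdGraph 2) O xR), N < t) : False := by
  classical
  set CL := siteCluster (zdGraph 2) O xL with hCL
  set CR := siteCluster (zdGraph 2) O xR with hCR
  obtain ⟨t₁, ht₁, -⟩ := hLb 0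
  obtain ⟨t₂, ht₂, h12⟩ := hRa t₁
  set N₀ : ℕ := t₁.natAbs + t₂.natAbs with hN₀
  have hbox : ∀ n : ℕ, mkSite t₁ 0 ∈ box 2 (n + N₀) ∧ mkSite t₂ 0 ∈ box 2 (n + N₀) := by
    intro n
    constructor <;> (rw [mem_box, Fin.forall_fin_two]; simp only [mkSite_apply_zero, mkSite_apply_one]; push_cast; omega)
  have h : ∀ n : ℕ, ∃ (g : ℤ) (v : Site 2) (q : zdStarGraph.Walk (mkSite g 0) v), t₁ < g ∧ g < t₂ ∧
      (∃ i, |v i| = (n + N₀ : ℕ)) ∧ ∀ z ∈ q.support, z ∈ box 2 (n + N₀) ∧ 0 ≤ z 1 ∧ z ∉ O := fun n =>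
    exists_dual_starWalk_between hO hL hR hdisj ht₁ ht₂ h12 (hbox n).1 (hbox n).2
  choose g v q hg using h
  -- a value `g₀` taken infinitely often
  have hgmem : ∀ n, g n ∈ Finset.Ioo t₁ t₂ := fun n => Finset.mem_Ioo.2 ⟨(hg n).1, (hg n).2.1⟩
  obtain ⟨⟨g₀, hg₀⟩, hfib⟩ := Finite.exists_infinite_fiber fun n : ℕ => (⟨g n, hgmem n⟩ : {z // z ∈ Finset.Ioo t₁ t₂})
  have hfib' : Set.Infinite ((fun n : ℕ => (⟨g n, hgmem n⟩ : {z // z ∈ Finset.Ioo t₁ t₂})) ⁻¹' {⟨g₀, hg₀⟩}) :=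
    Set.infinite_coe_iff.1 hfib
  have hfibmem : ∀ n, n ∈ ((fun n : ℕ => (⟨g n, hgmem n⟩ : {z // z ∈ Finset.Ioo t₁ t₂})) ⁻¹' {⟨g₀, hg₀⟩}) ↔ g n = g₀ := by
    intro n; simp [Subtype.ext_iff]
  rw [Finset.mem_Ioo] at hg₀
  -- the dual `∗`cluster of `(g₀, 0)` is infinite
  set J := siteCluster zdStarGraph (halfPlane 0 \ O) (mkSite g₀ 0) with hJ
  have hJinf : J.Infinite := by
    intro hfin
    obtain ⟨M, hM⟩ := exists_forall_subset_box 2 hfin.toFinset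
    obtain ⟨n, hn, hnM⟩ := hfib'.exists_gt M
    rw [hfibmem] at hn
    have hsupp : ∀ z ∈ (q n).support, z ∈ halfPlane 0 \ O := fun z hz => ⟨(hg n).2.2.2 z hz |>.2.1, (hg n).2.2.2 z hz |>.2.2⟩
    have hstart : mkSite (g n) 0 ∈ J := by
      rw [hn]; exact (mem_siteCluster_self_iff _ _ _).2 (hn ▸ hsupp _ (Walk.start_mem_support _))
    have hvJ : v n ∈ J := support_subset_cluster_of_mem (q n) hsupp (Walk.start_mem_support _) hstart _ (Walk.end_mem_support _)
    have hvM : v n ∈ box 2 M := hM M le_rfl (hfin.mem_toFinset.2 hvJ)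
    obtain ⟨i, hi⟩ := (hg n).2.2.1
    have := mem_box.1 hvM i
    rcases (abs_eq (by positivity)).1 hi with h | h <;> push_cast at h <;> omega
  have hJup : J ⊆ halfPlane 0 := fun z hz => (mem_of_mem_siteCluster hz).1
  have hJdisj : ∀ {x' : Site 2}, ∀ z ∈ J, z ∉ siteCluster (zdGraph 2) O x' := fun z hz hz' =>
    (mem_of_mem_siteCluster hz).2 (mem_of_mem_siteCluster hz')
  have hg₀J : mkSite g₀ 0 ∈ J := by
    obtain ⟨n, hn, -⟩ := hfib'.exists_gt 0
    rw [hfibmem] at hn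
    have := (hg n).2.2.2 _ (Walk.start_mem_support (q n))
    rw [hn] at this
    exact (mem_siteCluster_self_iff _ _ _).2 ⟨this.2.1, this.2.2⟩
  rcases unbounded_below_or_above (hTs _ hJinf) with hb | ha
  · obtain ⟨τ, hτ, hτt⟩ := hb t₁
    exact not_between_of_starArc hJup starConn_of_starCluster hO hL hJdisj hτ hg₀J ht₁ hτt hg₀.1
  · obtain ⟨τ, hτ, hτt⟩ := ha t₂
    exact not_between_of_starArc hJup starConn_of_starCluster hO hR hJdisj hg₀J hτ ht₂ hg₀.2 hτt

/-- **Uniqueness of the infinite lattice cluster of `π_up`** (Georgii–Higuchi 2000, Lemma 4.1, first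
part, deterministic core): if every infinite lattice cluster of sites of `O ⊆ π_up` and every
infinite `∗`cluster of `π_up ∖ O` touches the axis unboundedly, then two infinite lattice clusters of
sites of `O` coincide. [cite: GeorgiiHiguchi2000, Lemma 4.1] -/
theorem latticeCluster_unique_of_touching (hO : O ⊆ halfPlane 0)
    (hTl : ∀ x, (siteCluster (zdGraph 2) O x).Infinite → TouchesUnboundedly (siteCluster (zdGraph 2) O x))
    (hTs : ∀ x, (siteCluster zdStarGraph (halfPlane 0 \ O) x).Infinite → TouchesUnboundedly (siteCluster zdStarGraph (halfPlane 0 \ O) x))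
    {x₁ x₂ : Site 2} (h₁ : (siteCluster (zdGraph 2) O x₁).Infinite) (h₂ : (siteCluster (zdGraph 2) O x₂).Infinite) :
    siteCluster (zdGraph 2) O x₁ = siteCluster (zdGraph 2) O x₂ := by
  by_contra hne
  have hdisj : ∀ z ∈ siteCluster (zdGraph 2) O x₁, z ∉ siteCluster (zdGraph 2) O x₂ := fun z h1 h2 =>
    hne (siteCluster_eq_of_mem h1 h2)
  have hdisj' : ∀ z ∈ siteCluster (zdGraph 2) O x₂, z ∉ siteCluster (zdGraph 2) O x₁ := fun z h2 h1 => hdisj z h1 h2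
  have hup : ∀ x, siteCluster (zdGraph 2) O x ⊆ halfPlane 0 := fun x z hz => hO (mem_of_mem_siteCluster hz)
  -- both unbounded on the same side is impossible
  have hsame_below : ∀ {y₁ y₂ : Site 2}, (siteCluster (zdGraph 2) O y₁).Infinite → (siteCluster (zdGraph 2) O y₂).Infinite →
      (∀ z ∈ siteCluster (zdGraph 2) O y₁, z ∉ siteCluster (zdGraph 2) O y₂) →
      (∀ N : ℤ, ∃ t ∈ axisTrace (siteCluster (zdGraph 2) O y₁), t < N) →
      (∀ N : ℤ, ∃ t ∈ axisTrace (siteCluster (zdGraph 2) O y₂), t < N) → False := by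
    intro y₁ y₂ hi₁ hi₂ hd hb₁ hb₂
    obtain ⟨t, ht, -⟩ := hb₁ 0
    obtain ⟨s', hs', hs't⟩ := hb₂ t
    obtain ⟨t', ht', ht's⟩ := hb₁ s'
    exact not_between_of_starArc (hup y₁) starConn_of_latticeCluster hO hi₂ hd ht' ht hs' ht's hs't
  have hsame_above : ∀ {y₁ y₂ : Site 2}, (siteCluster (zdGraph 2) O y₁).Infinite → (siteCluster (zdGraph 2) O y₂).Infinite →
      (∀ z ∈ siteCluster (zdGraph 2) O y₁, z ∉ siteCluster (zdGraph 2) O y₂) →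
      (∀ N : ℤ, ∃ t ∈ axisTrace (siteCluster (zdGraph 2) O y₁), N < t) →
      (∀ N : ℤ, ∃ t ∈ axisTrace (siteCluster (zdGraph 2) O y₂), N < t) → False := by
    intro y₁ y₂ hi₁ hi₂ hd ha₁ ha₂
    obtain ⟨t, ht, -⟩ := ha₁ 0
    obtain ⟨s', hs', hs't⟩ := ha₂ t
    obtain ⟨t', ht', ht's⟩ := ha₁ s'
    exact not_between_of_starArc (hup y₁) starConn_of_latticeCluster hO hi₂ hd ht ht' hs' hs't ht's
  rcases unbounded_below_or_above (hTl x₁ h₁) with hb₁ | ha₁ <;>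
    rcases unbounded_below_or_above (hTl x₂ h₂) with hb₂ | ha₂
  · exact hsame_below h₁ h₂ hdisj hb₁ hb₂
  · exact false_of_ordered_latticeClusters hO hTs h₁ h₂ hdisj hb₁ ha₂
  · exact false_of_ordered_latticeClusters hO hTs h₂ h₁ hdisj' hb₂ ha₁
  · exact hsame_above h₁ h₂ hdisj ha₁ ha₂

end LatticeUnique

/-! ### Uniqueness of infinite `∗`clusters -/

section StarUnique

variable {O : Set (Site 2)}

/-- The reflection fixes sites of the axis. [folklore] -/
theorem Rf_eq_self_of_axis {z : Site 2} (hz : z 1 = 0) : Rf z = z := by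
  rw [eq_mkSite_of_axis hz, Rf_mkSite_zero]

/-- **A same-colour semicircuit is met**: if a `∗`-walk `σ` of sites of `O ⊆ π_up`, or its
reflection, has a vertex equal or lattice-adjacent to a site of a `∗`cluster `D` of sites of `O`,
then `σ` has a vertex in `D`. [folklore] -/
theorem exists_mem_support_mem_cluster (hO : O ⊆ halfPlane 0) {a b x : Site 2} (σ : zdStarGraph.Walk a b)
    (hσ : ∀ z ∈ σ.support, z ∈ O) {z z' : Site 2}
    (hz : z ∈ σ.support ∨ ∃ y ∈ σ.support, z = Rf y) (hz' : z' ∈ siteCluster zdStarGraph O x)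
    (hzz' : z = z' ∨ (zdGraph 2).Adj z z') : ∃ y ∈ σ.support, y ∈ siteCluster zdStarGraph O x := by
  have hz'1 : 0 ≤ z' 1 := hO (mem_of_mem_siteCluster hz')
  -- reduce to `z ∈ σ.support` equal or `∗`-adjacent to `z'`
  have key : ∀ y ∈ σ.support, (y = z' ∨ zdStarGraph.Adj y z') → ∃ y ∈ σ.support, y ∈ siteCluster zdStarGraph O x := by
    rintro y hy (rfl | hadj)
    · exact ⟨y, hy, hz'⟩
    · exact ⟨y, hy, by
        have := mem_siteCluster_of_adj hz' (hσ y hy) hadj.symm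
        exact this⟩
  rcases hz with hz | ⟨y, hy, rfl⟩
  · exact key z hz (hzz'.imp id fun h => zdGraph_le_zdStarGraph h)
  · have hy1 : 0 ≤ y 1 := hO (hσ y hy)
    refine key y hy ?_
    rcases hzz' with h | h
    · left
      have : y 1 = 0 := by have := congrArg (· 1) h; simp only [Rf_apply_one] at this; omega
      rw [← h, Rf_eq_self_of_axis this]
    · right
      rw [zdStarGraph_adj_iff]
      rcases (zdGraph_two_adj_iff _ _).1 h with ⟨h0, h1⟩ | ⟨h0, h1⟩ | ⟨h1, h0⟩ | ⟨h1, h0⟩ <;>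
        rw [Rf_apply_zero] at h0 <;> rw [Rf_apply_one] at h1 <;>
        refine ⟨?_, by rw [abs_le]; omega, by rw [abs_le]; omega⟩ <;> omega

/-- **The triple argument**: two disjoint infinite same-colour `∗`clusters `D₁` (touching unboundedly
to the left), `D₂` (any), and an infinite lattice cluster `I` of the other colour in `π_up`, all
touching the axis unboundedly, are impossible. [cite: GeorgiiHiguchi2000, Lemma 4.1 (proof)] -/
theorem false_of_triple (hO : O ⊆ halfPlane 0) {x₁ x₂ x₃ : Site 2}
    (h₂ : (siteCluster zdStarGraph O x₂).Infinite)
    (h₃ : (siteCluster (zdGraph 2) (halfPlane 0 \ O) x₃).Infinite)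
    (hdisj : ∀ z ∈ siteCluster zdStarGraph O x₁, z ∉ siteCluster zdStarGraph O x₂)
    (hT₂ : TouchesUnboundedly (siteCluster zdStarGraph O x₂)) (hT₃ : TouchesUnboundedly (siteCluster (zdGraph 2) (halfPlane 0 \ O) x₃))
    (hb₁ : ∀ N : ℤ, ∃ t ∈ axisTrace (siteCluster zdStarGraph O x₁), t < N) : False := by
  set D₁ := siteCluster zdStarGraph O x₁
  set D₂ := siteCluster zdStarGraph O x₂
  set I := siteCluster (zdGraph 2) (halfPlane 0 \ O) x₃
  have hdisj' : ∀ z ∈ D₂, z ∉ D₁ := fun z h2 h1 => hdisj z h1 h2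
  have hup : ∀ {x : Site 2}, siteCluster zdStarGraph O x ⊆ halfPlane 0 := fun hz => hO (mem_of_mem_siteCluster hz)
  have hIO : (halfPlane 0 \ O) ⊆ halfPlane 0 := fun z hz => hz.1
  have hDI : ∀ {x : Site 2}, ∀ z ∈ siteCluster zdStarGraph O x, z ∉ I := fun z hz hzI =>
    (mem_of_mem_siteCluster hzI).2 (mem_of_mem_siteCluster hz)
  -- `D₂` is unbounded above (not below)
  have ha₂ : ∀ N : ℤ, ∃ t ∈ axisTrace D₂, N < t := by
    rcases unbounded_below_or_above hT₂ with hb₂ | ha₂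
    · exfalso
      obtain ⟨t, ht, -⟩ := hb₁ 0
      obtain ⟨s', hs', hs't⟩ := hb₂ t
      obtain ⟨t', ht', ht's⟩ := hb₁ s'
      exact not_between_of_sameStar hO h₂ hdisj ht' ht hs' ht's hs't
    · exact ha₂
  -- every axis site of `I` is `≥ t₀ ∈ T(D₁)` and `≤ s₀ ∈ T(D₂)`
  obtain ⟨t₀, ht₀, -⟩ := hb₁ 0
  obtain ⟨s₀, hs₀, -⟩ := ha₂ 0
  have hge : ∀ τ ∈ axisTrace I, t₀ ≤ τ := fun τ hτ => by
    have := not_lt_of_unbounded_below (T := axisTrace D₁) (S := axisTrace I) hb₁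
      (fun t₁ ht₁ t₂ ht₂ s hs ⟨h1, h2⟩ => not_between_of_starArc hup starConn_of_starCluster hIO h₃ hDI ht₁ ht₂ hs h1 h2) hτ ht₀
    omega
  have hle : ∀ τ ∈ axisTrace I, τ ≤ s₀ := fun τ hτ => by
    have := not_gt_of_unbounded_above (T := axisTrace D₂) (S := axisTrace I) ha₂
      (fun t₁ ht₁ t₂ ht₂ s hs ⟨h1, h2⟩ => not_between_of_starArc hup starConn_of_starCluster hIO h₃ hDI ht₁ ht₂ hs h1 h2) hτ hs₀
    omega
  obtain ⟨τ, hτ, hbig⟩ := hT₃ (t₀.natAbs + s₀.natAbs)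
  have h1 := hge τ hτ; have h2 := hle τ hτ
  push_cast at hbig
  rw [lt_abs] at hbig
  rcases abs_cases t₀ with ⟨ha, _⟩ | ⟨ha, _⟩ <;> rcases abs_cases s₀ with ⟨hb, _⟩ | ⟨hb, _⟩ <;>
    rw [ha, hb] at hbig <;> omega

/-- **Uniqueness of the infinite `∗`cluster of `π_up`** (Georgii–Higuchi 2000, Lemma 4.1, first
part, deterministic core): if every infinite `∗`cluster of sites of `O ⊆ π_up` and every infinite
lattice cluster of `π_up ∖ O` touches the axis unboundedly, then two infinite `∗`clusters of sites of
`O` coincide. Two cases as in GH: an infinite lattice cluster of the other colour exists (triple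
argument), or not (same-colour `∗`semicircuits around every box, `exists_starSemicircuit_or_latticeEscape`). [cite: GeorgiiHiguchi2000, Lemma 4.1] -/
theorem starCluster_unique_of_touching (hO : O ⊆ halfPlane 0)
    (hTs : ∀ x, (siteCluster zdStarGraph O x).Infinite → TouchesUnboundedly (siteCluster zdStarGraph O x))
    (hTl : ∀ x, (siteCluster (zdGraph 2) (halfPlane 0 \ O) x).Infinite → TouchesUnboundedly (siteCluster (zdGraph 2) (halfPlane 0 \ O) x))
    {x₁ x₂ : Site 2} (h₁ : (siteCluster zdStarGraph O x₁).Infinite) (h₂ : (siteCluster zdStarGraph O x₂).Infinite) :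
    siteCluster zdStarGraph O x₁ = siteCluster zdStarGraph O x₂ := by
  classical
  by_contra hne
  have hdisj : ∀ z ∈ siteCluster zdStarGraph O x₁, z ∉ siteCluster zdStarGraph O x₂ := fun z h1 h2 =>
    hne (siteCluster_eq_of_mem h1 h2)
  have hdisj' : ∀ z ∈ siteCluster zdStarGraph O x₂, z ∉ siteCluster zdStarGraph O x₁ := fun z h2 h1 => hdisj z h1 h2
  by_cases hI : ∃ x₃, (siteCluster (zdGraph 2) (halfPlane 0 \ O) x₃).Infinite
  · -- the triple argument
    obtain ⟨x₃, h₃⟩ := hI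
    rcases unbounded_below_or_above (hTs x₁ h₁) with hb₁ | ha₁
    · exact false_of_triple hO h₂ h₃ hdisj (hTs x₂ h₂) (hTl x₃ h₃) hb₁
    · -- then `D₂` is unbounded below: swap the roles
      rcases unbounded_below_or_above (hTs x₂ h₂) with hb₂ | ha₂
      · exact false_of_triple hO h₁ h₃ hdisj' (hTs x₁ h₁) (hTl x₃ h₃) hb₂
      · obtain ⟨t, ht, -⟩ := ha₁ 0
        obtain ⟨s', hs', hs't⟩ := ha₂ t
        obtain ⟨t', ht', ht's⟩ := ha₁ s'
        exact not_between_of_sameStar hO h₂ hdisj ht ht' hs' hs't ht's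
  · -- no infinite lattice cluster of the other colour: same-colour `∗`semicircuits around every box
    push Not at hI
    have hx₁ : x₁ ∈ siteCluster zdStarGraph O x₁ := by
      obtain ⟨z, hz⟩ := h₁.nonempty
      exact (mem_siteCluster_self_iff _ _ _).2 hz.1
    have hx₂ : x₂ ∈ siteCluster zdStarGraph O x₂ := by
      obtain ⟨z, hz⟩ := h₂.nonempty
      exact (mem_siteCluster_self_iff _ _ _).2 hz.1
    obtain ⟨n, hn⟩ := exists_forall_subset_box 2 ({x₁, x₂} : Finset (Site 2))
    have hx₁n : x₁ ∈ box 2 n := hn n le_rfl (by simp)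
    have hx₂n : x₂ ∈ box 2 n := hn n le_rfl (by simp)
    -- some `N > n` carries an `O`-`∗`semicircuit
    obtain ⟨N, hnN, a, b, σ, ha1, hb1, ha0, hb0, hσ⟩ : ∃ N, n < N ∧ ∃ (a b : Site 2) (σ : zdStarGraph.Walk a b),
        a 1 = 0 ∧ b 1 = 0 ∧ a 0 < -(n : ℤ) ∧ (n : ℤ) < b 0 ∧ ∀ v ∈ σ.support, v ∈ annU N n ∧ v ∈ O := by
      by_contra hall
      push Not at hall
      -- escapes for all `N > n`: an infinite lattice cluster of the other colour
      have hesc : ∀ k : ℕ, ∃ (a b : Site 2) (w : (zdGraph 2).Walk a b), (∃ c ∈ box 2 n, (zdGraph 2).Adj a c) ∧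
          (∃ i, |b i| = (k + n + 1 : ℕ)) ∧ ∀ v ∈ w.support, v ∈ annU (k + n + 1) n ∧ v ∉ O := by
        intro k
        rcases exists_starSemicircuit_or_latticeEscape (n := n) (N := k + n + 1) (by omega) O with h | h
        · exact h
        · obtain ⟨a, b, q, ha1, hb1, ha0, hb0, hq⟩ := h
          obtain ⟨v, hv, hvimp⟩ := hall (k + n + 1) (by omega) a b q ha1 hb1 ha0 hb0
          exact absurd (hq v hv).2 (hvimp (hq v hv).1)
      choose a b w hw using hesc
      have hamem : ∀ k, a k ∈ box 2 (n + 1) := by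
        intro k
        obtain ⟨c, hc, hac⟩ := (hw k).1
        rw [mem_box, Fin.forall_fin_two] at hc ⊢
        push_cast
        rcases (zdGraph_two_adj_iff _ _).1 hac with ⟨h0, h1⟩ | ⟨h0, h1⟩ | ⟨h1, h0⟩ | ⟨h1, h0⟩ <;> omega
      obtain ⟨⟨a₀, ha₀⟩, hfib⟩ := Finite.exists_infinite_fiber fun k : ℕ => (⟨a k, hamem k⟩ : {z // z ∈ box 2 (n + 1)})
      have hfib' : Set.Infinite ((fun k : ℕ => (⟨a k, hamem k⟩ : {z // z ∈ box 2 (n + 1)})) ⁻¹' {⟨a₀, ha₀⟩}) :=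
        Set.infinite_coe_iff.1 hfib
      have hfibmem : ∀ k, k ∈ ((fun k : ℕ => (⟨a k, hamem k⟩ : {z // z ∈ box 2 (n + 1)})) ⁻¹' {⟨a₀, ha₀⟩}) ↔ a k = a₀ := by
        intro k; simp [Subtype.ext_iff]
      refine (?_ : (siteCluster (zdGraph 2) (halfPlane 0 \ O) a₀).Infinite) (hI a₀)
      intro hfin
      obtain ⟨M, hM⟩ := exists_forall_subset_box 2 hfin.toFinset
      obtain ⟨k, hk, hkM⟩ := hfib'.exists_gt M
      rw [hfibmem] at hk
      have hsupp : ∀ z ∈ (w k).support, z ∈ halfPlane 0 \ O := fun z hz => ⟨((hw k).2.2 z hz).1.2.2, ((hw k).2.2 z hz).2⟩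
      have hstart : a k ∈ siteCluster (zdGraph 2) (halfPlane 0 \ O) a₀ := by
        rw [hk]; exact (mem_siteCluster_self_iff _ _ _).2 (hk ▸ hsupp _ (Walk.start_mem_support _))
      have hbJ := support_subset_cluster_of_mem (w k) hsupp (Walk.start_mem_support _) hstart _ (Walk.end_mem_support _)
      have hbM : b k ∈ box 2 M := hM M le_rfl (hfin.mem_toFinset.2 hbJ)
      obtain ⟨i, hi⟩ := (hw k).2.1
      have := mem_box.1 hbM i
      rcases (abs_eq (by positivity)).1 hi with h | h <;> push_cast at h <;> omega
    -- both clusters meet `σ`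
    have hσO : ∀ v ∈ σ.support, v ∈ O := fun v hv => (hσ v hv).2
    have hσN : ∀ v ∈ σ.support, v ∈ box 2 N := fun v hv => (hσ v hv).1.1
    set σ' : zdStarGraph.Walk a b := (σ.map (starReflectHom 1)).copy (Rf_eq_self_of_axis ha1) (Rf_eq_self_of_axis hb1) with hσ'
    have hσ'supp : ∀ z ∈ σ'.support, ∃ y ∈ σ.support, z = Rf y := fun z hz => by
      rw [hσ', Walk.support_copy] at hz
      exact mem_support_map_starReflect σ z hz
    have hmeet : ∀ {x : Site 2}, x ∈ box 2 n → (siteCluster zdStarGraph O x).Infinite → x ∈ siteCluster zdStarGraph O x →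
        ∃ y ∈ σ.support, y ∈ siteCluster zdStarGraph O x := by
      intro x hxn hx hxx
      obtain ⟨w, hwD, hwN⟩ := exists_mem_siteCluster_not_mem_box hx N
      obtain ⟨β, hβ⟩ := exists_walk_in_siteCluster hxx hwD
      have hxn' := mem_box.1 hxn
      obtain ⟨z, hz, z', hz'β, hzz'⟩ := exists_touch_of_bandSemicircuits (m := n) (c₁ := -(n : ℤ)) (c₂ := n) ha0 hb0
        rfl ha1 rfl hb1 σ (fun z hz ⟨h0, h0', h1'⟩ => (hσ z hz).1.2.1 (mem_box.2 fun i => by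
          fin_cases i
          · exact ⟨h0, h0'⟩
          · exact ⟨by have := (hσ z hz).1.2.2; simp; omega, h1'⟩))
        σ' (fun z hz ⟨h0, h0', h1'⟩ => by
          obtain ⟨y, hy, rfl⟩ := hσ'supp z hz
          rw [Rf_apply_zero] at h0 h0'; rw [Rf_apply_one] at h1'
          exact (hσ y hy).1.2.1 (mem_box.2 fun i => by
            fin_cases i
            · exact ⟨h0, h0'⟩
            · exact ⟨by have := (hσ y hy).1.2.2; simp; omega, by simp; omega⟩))
        hσN (fun z hz => by
          obtain ⟨y, hy, rfl⟩ := hσ'supp z hz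
          exact mem_box_Rf_iff.2 (hσN y hy))
        (u := x) ⟨(hxn' 0).1, (hxn' 0).2, (hxn' 1).1, (hxn' 1).2⟩ hwN β
      refine exists_mem_support_mem_cluster hO σ hσO (z := z) ?_ (hβ z' hz'β) hzz'
      rcases hz with hz | hz
      · exact Or.inl hz
      · exact Or.inr (hσ'supp z hz)
    obtain ⟨y₁, hy₁, hy₁D⟩ := hmeet hx₁n h₁ hx₁
    obtain ⟨y₂, hy₂, hy₂D⟩ := hmeet hx₂n h₂ hx₂
    have hall := support_subset_cluster_of_mem σ hσO hy₁ hy₁D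
    exact hdisj y₂ (hall y₂ hy₂) hy₂D

end StarUnique

/-! ### Almost-sure uniqueness for Ising Gibbs measures above `β_c` -/

section AlmostSure

variable {β : ℝ} {μ : Measure (SpinConfig (Site 2))}

/-- The other colour in the upper half-plane. [folklore] -/
theorem halfPlane_diff_spinSites (s : ℤˣ) (ω : SpinConfig (Site 2)) :
    halfPlane 0 \ (spinSites s ω ∩ halfPlane 0) = spinSites (-s) ω ∩ halfPlane 0 := by
  ext z
  simp only [Set.mem_sdiff, Set.mem_inter_iff, mem_spinSites, not_and]
  rcases Int.units_eq_one_or s with rfl | rfl <;> rcases Int.units_eq_one_or (ω z) with h | h <;> simp [h]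

/-- From the line-touching form to `TouchesUnboundedly`. [folklore] -/
theorem touchesUnboundedly_of_io {C : Set (Site 2)} (h : ∀ n : ℕ, ∃ y ∈ C, y 1 = 0 ∧ (n : ℤ) < |y 0|) :
    TouchesUnboundedly C := fun n => by
  obtain ⟨y, hy, hy1, hy0⟩ := h n
  exact ⟨y 0, by change mkSite (y 0) 0 ∈ C; rwa [← eq_mkSite_of_axis hy1], hy0⟩

/-- **Almost surely every infinite cluster of `π_up` (both colours, lattice and `∗`) touches the axis
unboundedly** (`β > β_c(2)`, `μ ∈ 𝒢(β, 0)`): the tree's line touching lemma and its spin flip. [cite: GeorgiiHiguchi2000, Lemma 4.1] -/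
theorem ae_touchesUnboundedly (hβc : criticalBeta 2 < β) (hμ : μ ∈ isingGibbsMeasures 2 β 0) (s : ℤˣ)
    {G : SimpleGraph (Site 2)} [G.LocallyFinite] (hnn : zdGraph 2 ≤ G) (hst : G ≤ zdStarGraph) :
    ∀ᵐ ω ∂μ, ∀ x, (siteCluster G (spinSites s ω ∩ halfPlane 0) x).Infinite →
      TouchesUnboundedly (siteCluster G (spinSites s ω ∩ halfPlane 0) x) := by
  rcases Int.units_eq_one_or s with rfl | rfl
  · filter_upwards [ae_infinite_cluster_touches_axis_io (G := G) hβc hnn hst hμ] with ω hω x hx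
    exact touchesUnboundedly_of_io (hω x hx)
  · filter_upwards [ae_minus_touches_axis_io (G := G) hβc hnn hst hμ] with ω hω x hx
    exact touchesUnboundedly_of_io (hω x hx)

/-- **Uniqueness of the infinite lattice cluster of each colour in the upper half-plane, almost
surely** (Georgii–Higuchi 2000, Lemma 4.1, first statement; all cases). [cite: GeorgiiHiguchi2000, Lemma 4.1] -/
theorem ae_latticeCluster_unique_halfPlane (hβc : criticalBeta 2 < β) (hμ : μ ∈ isingGibbsMeasures 2 β 0) (s : ℤˣ) :
    ∀ᵐ ω ∂μ, ∀ x₁ x₂, (siteCluster (zdGraph 2) (spinSites s ω ∩ halfPlane 0) x₁).Infinite →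
      (siteCluster (zdGraph 2) (spinSites s ω ∩ halfPlane 0) x₂).Infinite →
      siteCluster (zdGraph 2) (spinSites s ω ∩ halfPlane 0) x₁ = siteCluster (zdGraph 2) (spinSites s ω ∩ halfPlane 0) x₂ := by
  filter_upwards [ae_touchesUnboundedly hβc hμ s (G := zdGraph 2) le_rfl zdGraph_le_zdStarGraph,
    ae_touchesUnboundedly hβc hμ (-s) (G := zdStarGraph) zdGraph_le_zdStarGraph le_rfl] with ω hl hs x₁ x₂ h₁ h₂
  refine latticeCluster_unique_of_touching Set.inter_subset_right hl (fun x hx => ?_) h₁ h₂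
  rw [halfPlane_diff_spinSites] at hx ⊢
  exact hs x hx

/-- **Uniqueness of the infinite `∗`cluster of each colour in the upper half-plane, almost surely**
(Georgii–Higuchi 2000, Lemma 4.1, first statement; all cases). [cite: GeorgiiHiguchi2000, Lemma 4.1] -/
theorem ae_starCluster_unique_halfPlane (hβc : criticalBeta 2 < β) (hμ : μ ∈ isingGibbsMeasures 2 β 0) (s : ℤˣ) :
    ∀ᵐ ω ∂μ, ∀ x₁ x₂, (siteCluster zdStarGraph (spinSites s ω ∩ halfPlane 0) x₁).Infinite →
      (siteCluster zdStarGraph (spinSites s ω ∩ halfPlane 0) x₂).Infinite →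
      siteCluster zdStarGraph (spinSites s ω ∩ halfPlane 0) x₁ = siteCluster zdStarGraph (spinSites s ω ∩ halfPlane 0) x₂ := by
  filter_upwards [ae_touchesUnboundedly hβc hμ s (G := zdStarGraph) zdGraph_le_zdStarGraph le_rfl,
    ae_touchesUnboundedly hβc hμ (-s) (G := zdGraph 2) le_rfl zdGraph_le_zdStarGraph] with ω hs hl x₁ x₂ h₁ h₂
  refine starCluster_unique_of_touching Set.inter_subset_right hs (fun x hx => ?_) h₁ h₂
  rw [halfPlane_diff_spinSites] at hx ⊢
  exact hl x hx

end AlmostSure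

end Literature.Probability.LatticeModels
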